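import Summits.Ventures.CertifiedManyBodySolver.Downfold.EmeryBandReductionAcrossCu
import Literature.Probability.LatticeModels.SRWHeatKernelHalfAngle
import HarnessLib

/-!
# Every constant-energy contour of the σ three-band (Emery) model is EXACTLY a `t–t′` one-band
# contour: the Fermi-surface shape `t′/t` of the antibonding band in closed form

Venture CertifiedManyBodySolver, cell `pub/hubbard-downfold` (stage S1, HUMAN RULINGS D-0096/D-0098:
the three-band → one-band reduction error is carried explicitly, never hidden), seat
hubbard-downfold-mod-4 (technique B = band level); namespace
`Summit.Ventures.CertifiedManyBodySolver.Downfold.Emery`. Everything here is PROVED (exact algebra).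
WHAT THIS IS NOT: not a statement about any material (no literature number lives here); not the
interaction (`U`) reduction; the SCALE of the pair `(fsT, fsTp)` below is conventional — only their
RATIO and the contour they define are physical (the energy scale `t` of a near-Fermi-surface refit needs
the band VELOCITY, i.e. the energy derivative of the secular function, which is not a polynomial in k).

Variables. `x = sin²(kx/2) = (1 − cos kx)/2`, `y = sin²(ky/2)` (the variables of
[AndersenEtAl1995, §6, text after Eq. (21)]: «the constant energy contour for an arbitrary energy is a
polynomial of second order in `x = ½(1 − cos a kx)` and in `y`»).

* §1 `oneBandXY` — the hubbard-fast one-band form `ε₁ = c − 2t(cos kx + cos ky) − 4t′cos kx cos ky −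
  2t″(cos 2kx + cos 2ky)` (`EmeryBlochBand.oneBand`) IS the symmetric quadratic polynomial
  `(c − 4t − 4t′ − 4t″) + (4t + 8t′ + 16t″)(x + y) − 16t′·xy − 16t″·(x² + y²)` (`oneBand_eq_oneBandXY`,
  `oneBandXY_eq_symQuad`, inverse `symQuad_eq_oneBandXY`): hopping RANGE = polynomial DEGREE, `t′` is the
  `xy` coefficient, `t″` the `x² + y²` coefficient.
* §2 `charCubic` — minus the characteristic determinant of the Bloch matrix with `t_pp′`
  (`EmeryBandReductionAcrossCu.bloch4`; `det_bloch4_sub_eq_neg_charCubic`) is, at FIXED energy `ε`,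
  BILINEAR in `(x, y)`: `charCubic = cA(ε) − 4·fsD(ε)·(x + y) − 16·fsN(ε)·xy` (`charCubic_bilinear`) with
  `fsD = (Δ + ε)(t_pd² − t_pp′ε)` and `fsN = 2t_pd²(t_pp′ + t_pp) + ε(t_pp² − t_pp′²)` — NO `x²`, `y²` term.
* §3 THE CONTOUR THEOREM (`charCubic_eq_zero_iff_oneBandXY`, k-space `det_bloch4_eq_zero_iff_oneBand`):
  for every energy `ε`, `{k : det(H(k) − ε) = 0}` is a level set of the PURE `t–t′` one-band form with
  `t = fsD + 2fsN`, `t′ = −fsN` (and `t″ = 0`); hence the Fermi surface of the σ three-band model at ANY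
  filling is exactly a `t–t′` Fermi surface with `t′/t = fsRatio(ε_F) = −fsN/(fsD + 2fsN) =
  −1/(fsD/fsN + 2)` (`fsRatio`, `fsTp_div_fsT`). COROLLARIES: the pure d–p model (`t_pp = t_pp′ = 0`)
  is PERFECTLY NESTED at every filling (`fsN_pure_dp`, `fermiContour_pure_dp_nested`: `cos kx + cos ky
  = const`); the Fermi-surface curvature is generated by `t_pp` and `t_pp′` with weight `2t_pd²`; in the
  cuprate regime (`fsD > 0`, `fsN > 0`) the sign is cuprate-like and `−1/2 < t′/t < 0`
  (`fsRatio_neg`, `neg_half_lt_fsRatio`). The energy-INDEPENDENT `(t, t′, t″)` form of technique B trades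
  the energy dependence of `(fsD : fsN)(ε)` for `t″` plus a misfit — the one-band-form misfit `ρ` of the
  cell's rule `INFLATION-RULES-3to1-B` R-B2 is that price, nothing else.
* §4 SCALE COVARIANCE (`charCubic_smul`, `fsRatio_smul`): multiplying `(Δ, t_pd, t_pp, t_pp′, ε)` by a
  common `λ ≠ 0` leaves every contour and `t′/t` unchanged — a uniform rescaling of all σ energies (the
  zeroth-order effect of compression) cannot move `t′/t`; only RATIOS of three-band parameters move it
  (kernel face of `INFLATION-RULES-3to1-B` §B.12(f)).
* Companion file `EmeryFermiSurfaceShapeBox`: MONOTONICITY AND THE BOX RULE — `fsRatio` is increasing in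
  `fsD`, decreasing in `fsN`; corner enclosures of `fsD`, `fsN` over a three-band parameter box and a
  Fermi-energy bracket give a CERTIFIED interval for the near-Fermi-surface `t′/t` (the cell's object E)
  with no fitting and no energy window.

Sources: three-band model [HybertsenSchluterChristensen1989, Eq. (1)]; polynomial-in-`(x, y)` contour
language and the `t, t′, t″` one-band form [AndersenEtAl1995, §6]; [PavariniEtAl2001, Eq. (1)].
-/

noncomputable section

namespace Summit.Ventures.CertifiedManyBodySolver.Downfold.Emery

open Real

/-! ## §1 The one-band form in the half-angle variables `x = sin²(kx/2)`, `y = sin²(ky/2)` -/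

/-- The one-band `t–t′–t″` dispersion written in `x = sin²(kx/2)`, `y = sin²(ky/2)`
(`cos k = 1 − 2 sin²(k/2)`, `cos 2k = 1 − 8 sin²(k/2) + 8 sin⁴(k/2)`).
[cite: AndersenEtAl1995, §6 (variables `x = ½(1 − cos a kx)`, `y`)] -/
def oneBandXY (c t t' t'' x y : ℝ) : ℝ :=
  c - 2 * t * ((1 - 2 * x) + (1 - 2 * y)) - 4 * t' * ((1 - 2 * x) * (1 - 2 * y))
    - 2 * t'' * ((1 - 8 * x + 8 * x ^ 2) + (1 - 8 * y + 8 * y ^ 2))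

/-- `cos 2k = 1 − 8 sin²(k/2) + 8 (sin²(k/2))²`. [folklore] -/
theorem cos_two_mul_eq_sin_half (k : ℝ) :
    Real.cos (2 * k) = 1 - 8 * Real.sin (k / 2) ^ 2 + 8 * (Real.sin (k / 2) ^ 2) ^ 2 := by
  rw [Real.cos_two_mul, Literature.Probability.LatticeModels.cos_eq_one_sub_two_mul_sin_half_sq k]
  ring

/-- The D0 one-band form `EmeryBlochBand.oneBand` equals `oneBandXY` at `x = sin²(kx/2)`,
`y = sin²(ky/2)`. [cite: AndersenEtAl1995, §6] -/
theorem oneBand_eq_oneBandXY (c t t' t'' kx ky : ℝ) :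
    oneBand c t t' t'' kx ky = oneBandXY c t t' t'' (Real.sin (kx / 2) ^ 2) (Real.sin (ky / 2) ^ 2) := by
  unfold oneBand oneBandXY
  rw [cos_two_mul_eq_sin_half kx, cos_two_mul_eq_sin_half ky,
    Literature.Probability.LatticeModels.cos_eq_one_sub_two_mul_sin_half_sq kx,
    Literature.Probability.LatticeModels.cos_eq_one_sub_two_mul_sin_half_sq ky]

/-- HOPPING RANGE = POLYNOMIAL DEGREE: the `t–t′–t″` form is the symmetric quadratic
`(c − 4t − 4t′ − 4t″) + (4t + 8t′ + 16t″)(x + y) − 16t′·xy − 16t″·(x² + y²)`; `t′` is the `xy`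
coefficient, `t″` the `x² + y²` coefficient. [cite: AndersenEtAl1995, §6] -/
theorem oneBandXY_eq_symQuad (c t t' t'' x y : ℝ) :
    oneBandXY c t t' t'' x y = (c - 4 * t - 4 * t' - 4 * t'') + (4 * t + 8 * t' + 16 * t'') * (x + y)
      - 16 * t' * (x * y) - 16 * t'' * (x ^ 2 + y ^ 2) := by
  unfold oneBandXY
  ring

/-- Conversely every symmetric quadratic `a₀ + a₁(x + y) + a₂·xy + a₃(x² + y²)` is a `t–t′–t″` form:
`t″ = −a₃/16`, `t′ = −a₂/16`, `t = (a₁ + a₂/2 + a₃)/4`, `c = a₀ + a₁ + a₂/4 + 3a₃/4`. [folklore] -/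
theorem symQuad_eq_oneBandXY (a₀ a₁ a₂ a₃ x y : ℝ) :
    a₀ + a₁ * (x + y) + a₂ * (x * y) + a₃ * (x ^ 2 + y ^ 2) =
      oneBandXY (a₀ + a₁ + a₂ / 4 + 3 * a₃ / 4) ((a₁ + a₂ / 2 + a₃) / 4) (-a₂ / 16) (-a₃ / 16) x y := by
  unfold oneBandXY
  ring

/-! ## §2 The characteristic cubic is bilinear in `(x, y)` at fixed energy -/

/-- Minus the characteristic determinant of the three-band Bloch matrix with `t_pp′ = c`, as a function of
`x = sx²`, `y = sy²` and the energy `ε` (a monic cubic in `ε`):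
`ε[(Δ + 4cx + ε)(Δ + 4cy + ε) − 16t_pp²xy] − 4t_pd²x(Δ + 4cy + ε) − 4t_pd²y(Δ + 4cx + ε) − 32t_pd²t_pp·xy`.
[cite: HybertsenSchluterChristensen1989, Eq. (1) (three-band d–p model)] -/
def charCubic (Δ tpd tpp c x y ε : ℝ) : ℝ :=
  ε * ((Δ + 4 * c * x + ε) * (Δ + 4 * c * y + ε) - 16 * tpp ^ 2 * x * y)
    - 4 * tpd ^ 2 * x * (Δ + 4 * c * y + ε) - 4 * tpd ^ 2 * y * (Δ + 4 * c * x + ε)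
    - 32 * tpd ^ 2 * tpp * x * y

/-- `det(bloch4 − ε·1) = −charCubic(sx², sy², ε)`: the secular equation of the σ three-band model depends
on k only through `x = sx²`, `y = sy²`. [folklore] -/
theorem det_bloch4_sub_eq_neg_charCubic (Δ tpd tpp c sx sy ε : ℝ) :
    (bloch4 Δ tpd tpp c sx sy - ε • (1 : Matrix (Fin 3) (Fin 3) ℝ)).det =
      -charCubic Δ tpd tpp c (sx ^ 2) (sy ^ 2) ε := by
  rw [det_bloch4_sub]
  unfold charCubic
  ring

/-- Same for the `t_pp′ = 0` matrix `EmeryBlochBand.bloch`. [folklore] -/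
theorem det_bloch_sub_eq_neg_charCubic (Δ tpd tpp sx sy ε : ℝ) :
    (bloch Δ tpd tpp sx sy - ε • (1 : Matrix (Fin 3) (Fin 3) ℝ)).det =
      -charCubic Δ tpd tpp 0 (sx ^ 2) (sy ^ 2) ε := by
  rw [← bloch4_zero, det_bloch4_sub_eq_neg_charCubic]

/-- The k-independent coefficient `cA(ε) = ε(Δ + ε)²` (value of `charCubic` at Γ: roots `0`, `−Δ`, `−Δ`).
[folklore] -/
def cA (Δ ε : ℝ) : ℝ := ε * (Δ + ε) ^ 2

/-- The nearest-neighbour ("`t`-type") weight of the secular function at energy `ε`: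
`fsD = (Δ + ε)(t_pd² − t_pp′ε)`. [folklore] -/
def fsD (Δ tpd c ε : ℝ) : ℝ := (Δ + ε) * (tpd ^ 2 - c * ε)

/-- The diagonal ("`t′`-type") weight of the secular function at energy `ε`:
`fsN = 2t_pd²(t_pp′ + t_pp) + ε(t_pp² − t_pp′²)` — generated by the oxygen–oxygen hoppings only.
[folklore] -/
def fsN (tpd tpp c ε : ℝ) : ℝ := 2 * tpd ^ 2 * (c + tpp) + ε * (tpp ^ 2 - c ^ 2)

/-- BILINEARITY: at fixed energy the characteristic cubic is `cA − 4·fsD·(x + y) − 16·fsN·xy` — no `x²`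
or `y²` term. [cite: AndersenEtAl1995, §6 («the constant energy contour for an arbitrary energy is a
polynomial of second order in x and in y»)] -/
theorem charCubic_bilinear (Δ tpd tpp c x y ε : ℝ) :
    charCubic Δ tpd tpp c x y ε = cA Δ ε - 4 * fsD Δ tpd c ε * (x + y) - 16 * fsN tpd tpp c ε * (x * y) := by
  unfold charCubic cA fsD fsN
  ring

/-! ## §3 The contour theorem: constant-energy contours are `t–t′` contours -/

/-- Shape-normalised nearest-neighbour hopping of the contour at energy `ε`: `fsT = fsD + 2·fsN`
(conventional scale; only `fsTp/fsT` is physical). [folklore] -/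
def fsT (Δ tpd tpp c ε : ℝ) : ℝ := fsD Δ tpd c ε + 2 * fsN tpd tpp c ε

/-- Shape-normalised diagonal hopping of the contour at energy `ε`: `fsTp = −fsN` (same conventional
scale as `fsT`). [folklore] -/
def fsTp (tpd tpp c ε : ℝ) : ℝ := -fsN tpd tpp c ε

/-- The Fermi-surface-shape hopping ratio of the σ three-band model at energy `ε`:
`(t′/t)_FS(ε) = −fsN/(fsD + 2fsN)`. [folklore] -/
def fsRatio (Δ tpd tpp c ε : ℝ) : ℝ := -fsN tpd tpp c ε / (fsD Δ tpd c ε + 2 * fsN tpd tpp c ε)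

/-- The characteristic cubic IS (minus) a pure `t–t′` one-band form in `(x, y)` up to an additive
constant: `charCubic = cA − [oneBandXY γ fsT fsTp 0 − (γ − 4fsT − 4fsTp)]` for any `γ`. [folklore] -/
theorem charCubic_eq_oneBandXY (Δ tpd tpp c x y ε γ : ℝ) :
    charCubic Δ tpd tpp c x y ε =
      cA Δ ε - (oneBandXY γ (fsT Δ tpd tpp c ε) (fsTp tpd tpp c ε) 0 x y
        - (γ - 4 * fsT Δ tpd tpp c ε - 4 * fsTp tpd tpp c ε)) := by
  rw [charCubic_bilinear]
  unfold oneBandXY fsT fsTp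
  ring

/-- THE CONTOUR THEOREM in `(x, y)`: the secular equation `charCubic(x, y, ε) = 0` holds iff `(x, y)` lies
on the level set `oneBandXY γ fsT(ε) fsTp(ε) 0 = γ − 4fsT − 4fsTp + cA(ε)` of the pure `t–t′` form
(`t″ = 0`) with `t′/t = fsRatio(ε)`. Holds for each of the three bands at its own energies.
[cite: AndersenEtAl1995, §6] -/
theorem charCubic_eq_zero_iff_oneBandXY (Δ tpd tpp c x y ε γ : ℝ) :
    charCubic Δ tpd tpp c x y ε = 0 ↔
      oneBandXY γ (fsT Δ tpd tpp c ε) (fsTp tpd tpp c ε) 0 x y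
        = γ - 4 * fsT Δ tpd tpp c ε - 4 * fsTp tpd tpp c ε + cA Δ ε := by
  rw [charCubic_eq_oneBandXY Δ tpd tpp c x y ε γ]
  constructor <;> intro h <;> linarith

/-- THE CONTOUR THEOREM in k-space: `ε` is a band energy of the σ three-band model at `k = (kx, ky)`
(`det(H(k) − ε) = 0`, `H = bloch4` at `sx = sin(kx/2)`, `sy = sin(ky/2)`) iff `k` lies on the
constant-energy contour `oneBand γ fsT(ε) fsTp(ε) 0 k = γ − 4fsT − 4fsTp + cA(ε)` of the `t–t′` one-band
dispersion with `t′/t = fsRatio(ε)`: every constant-energy contour — in particular the Fermi surface at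
any filling — of the Emery antibonding band is EXACTLY a `t–t′` contour. [cite: AndersenEtAl1995, §6] -/
theorem det_bloch4_eq_zero_iff_oneBand (Δ tpd tpp c kx ky ε γ : ℝ) :
    (bloch4 Δ tpd tpp c (Real.sin (kx / 2)) (Real.sin (ky / 2))
        - ε • (1 : Matrix (Fin 3) (Fin 3) ℝ)).det = 0 ↔
      oneBand γ (fsT Δ tpd tpp c ε) (fsTp tpd tpp c ε) 0 kx ky
        = γ - 4 * fsT Δ tpd tpp c ε - 4 * fsTp tpd tpp c ε + cA Δ ε := by
  rw [det_bloch4_sub_eq_neg_charCubic, neg_eq_zero, oneBand_eq_oneBandXY]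
  exact charCubic_eq_zero_iff_oneBandXY _ _ _ _ _ _ _ _

/-- The ratio of the contour hoppings is `fsRatio`: `fsTp/fsT = −fsN/(fsD + 2fsN)`. [folklore] -/
theorem fsTp_div_fsT (Δ tpd tpp c ε : ℝ) :
    fsTp tpd tpp c ε / fsT Δ tpd tpp c ε = fsRatio Δ tpd tpp c ε := rfl

/-- `fsRatio = −1/(q + 2)` with the single shape parameter `q = fsD/fsN` (when `fsN ≠ 0`).
[folklore] -/
theorem fsRatio_eq_inv (Δ tpd tpp c ε : ℝ) (hN : fsN tpd tpp c ε ≠ 0) :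
    fsRatio Δ tpd tpp c ε = -1 / (fsD Δ tpd c ε / fsN tpd tpp c ε + 2) := by
  unfold fsRatio
  have h2 : fsD Δ tpd c ε / fsN tpd tpp c ε + 2 = (fsD Δ tpd c ε + 2 * fsN tpd tpp c ε) / fsN tpd tpp c ε := by
    field_simp
  rw [h2, div_div_eq_mul_div, neg_one_mul]

/-- PURE d–p MODEL: with `t_pp = t_pp′ = 0` the diagonal weight vanishes at every energy. [folklore] -/
theorem fsN_pure_dp (tpd ε : ℝ) : fsN tpd 0 0 ε = 0 := by
  unfold fsN
  ring

/-- Hence the pure d–p model has `t′/t = 0` on every contour. [folklore] -/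
theorem fsRatio_pure_dp (Δ tpd ε : ℝ) : fsRatio Δ tpd 0 0 ε = 0 := by
  unfold fsRatio
  rw [fsN_pure_dp]
  simp

/-- PERFECT NESTING of the pure d–p model: at every energy with `fsD(ε) ≠ 0` the contour is
`x + y = cA/(4·fsD)`. [folklore] -/
theorem charCubic_pure_dp_eq_zero_iff (Δ tpd x y ε : ℝ) (hD : fsD Δ tpd 0 ε ≠ 0) :
    charCubic Δ tpd 0 0 x y ε = 0 ↔ x + y = cA Δ ε / (4 * fsD Δ tpd 0 ε) := by
  rw [charCubic_bilinear, fsN_pure_dp]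
  have h4 : 4 * fsD Δ tpd 0 ε ≠ 0 := mul_ne_zero (by norm_num) hD
  rw [eq_div_iff h4]
  constructor <;> intro h <;> linarith [mul_comm (x + y) (4 * fsD Δ tpd 0 ε)]

/-- PERFECT NESTING in k-space: every constant-energy contour of the pure d–p model (`t_pp = t_pp′ = 0`)
is `cos kx + cos ky = const` — the `t′ = 0` square-lattice contour, at every filling. [folklore] -/
theorem fermiContour_pure_dp_nested (Δ tpd kx ky ε : ℝ) (hD : fsD Δ tpd 0 ε ≠ 0) :
    (bloch Δ tpd 0 (Real.sin (kx / 2)) (Real.sin (ky / 2))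
        - ε • (1 : Matrix (Fin 3) (Fin 3) ℝ)).det = 0 ↔
      Real.cos kx + Real.cos ky = 2 - 2 * (cA Δ ε / (4 * fsD Δ tpd 0 ε)) := by
  rw [det_bloch_sub_eq_neg_charCubic, neg_eq_zero, charCubic_pure_dp_eq_zero_iff _ _ _ _ _ hD,
    Literature.Probability.LatticeModels.cos_eq_one_sub_two_mul_sin_half_sq kx,
    Literature.Probability.LatticeModels.cos_eq_one_sub_two_mul_sin_half_sq ky]
  constructor <;> intro h <;> linarith

/-- CUPRATE SIGN: in the regime `fsD > 0`, `fsN > 0` (charge-transfer regime `Δ + ε > 0`,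
`t_pp′ε < t_pd²`, and `t_pp, t_pp′ ≥ 0` not both zero with `(t_pp′ − t_pp)ε < 2t_pd²`) the Fermi-surface
`t′/t` is NEGATIVE (cuprate-like) at every such energy. [folklore] -/
theorem fsRatio_neg {Δ tpd tpp c ε : ℝ} (hD : 0 < fsD Δ tpd c ε) (hN : 0 < fsN tpd tpp c ε) :
    fsRatio Δ tpd tpp c ε < 0 := by
  unfold fsRatio
  apply div_neg_of_neg_of_pos
  · linarith
  · linarith

/-- … and larger than `−1/2`: `−1/2 < (t′/t)_FS < 0`. [folklore] -/
theorem neg_half_lt_fsRatio {Δ tpd tpp c ε : ℝ} (hD : 0 < fsD Δ tpd c ε) (hN : 0 < fsN tpd tpp c ε) :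
    -(1 / 2 : ℝ) < fsRatio Δ tpd tpp c ε := by
  unfold fsRatio
  rw [neg_div, lt_neg, neg_neg, div_lt_iff₀ (by linarith)]
  linarith

/-- Sufficient parameter conditions for the cuprate regime: `Δ + ε > 0` and `t_pp′·ε < t_pd²` give
`fsD > 0`. [folklore] -/
theorem fsD_pos {Δ tpd c ε : ℝ} (hΔ : 0 < Δ + ε) (hc : c * ε < tpd ^ 2) : 0 < fsD Δ tpd c ε := by
  unfold fsD
  exact mul_pos hΔ (by linarith)

/-- Sufficient parameter conditions for the cuprate regime: `t_pd ≠ 0`, `0 ≤ t_pp′ ≤ t_pp`, `0 < t_pp`,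
`ε ≥ 0` give `fsN > 0`. [folklore] -/
theorem fsN_pos {tpd tpp c ε : ℝ} (htpd : tpd ≠ 0) (hc : 0 ≤ c) (hct : c ≤ tpp) (htpp : 0 < tpp)
    (hε : 0 ≤ ε) : 0 < fsN tpd tpp c ε := by
  unfold fsN
  have h2 : 0 < tpd ^ 2 := by positivity
  have h3 : 0 ≤ ε * (tpp ^ 2 - c ^ 2) := mul_nonneg hε (by nlinarith)
  nlinarith

/-! ## §4 Scale covariance: a common rescaling of all σ energies moves no contour and no `t′/t` -/

/-- `charCubic` is homogeneous of degree 3 under `(Δ, t_pd, t_pp, t_pp′, ε) ↦ λ·(…)` at fixed k.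
[folklore] -/
theorem charCubic_smul (l Δ tpd tpp c x y ε : ℝ) :
    charCubic (l * Δ) (l * tpd) (l * tpp) (l * c) x y (l * ε) = l ^ 3 * charCubic Δ tpd tpp c x y ε := by
  unfold charCubic
  ring

/-- `fsD` is homogeneous of degree 3. [folklore] -/
theorem fsD_smul (l Δ tpd c ε : ℝ) : fsD (l * Δ) (l * tpd) (l * c) (l * ε) = l ^ 3 * fsD Δ tpd c ε := by
  unfold fsD
  ring

/-- `fsN` is homogeneous of degree 3. [folklore] -/
theorem fsN_smul (l tpd tpp c ε : ℝ) :
    fsN (l * tpd) (l * tpp) (l * c) (l * ε) = l ^ 3 * fsN tpd tpp c ε := by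
  unfold fsN
  ring

/-- SCALE INVARIANCE of the Fermi-surface `t′/t`: for `λ ≠ 0`,
`fsRatio(λΔ, λt_pd, λt_pp, λt_pp′, λε) = fsRatio(Δ, t_pd, t_pp, t_pp′, ε)` — a uniform rescaling of all σ
energies (bandwidth scaling under compression at fixed ratios) cannot move `t′/t`. [folklore] -/
theorem fsRatio_smul {l : ℝ} (hl : l ≠ 0) (Δ tpd tpp c ε : ℝ) :
    fsRatio (l * Δ) (l * tpd) (l * tpp) (l * c) (l * ε) = fsRatio Δ tpd tpp c ε := by
  unfold fsRatio
  rw [fsD_smul, fsN_smul]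
  have h3 : l ^ 3 ≠ 0 := pow_ne_zero 3 hl
  rw [show l ^ 3 * fsD Δ tpd c ε + 2 * (l ^ 3 * fsN tpd tpp c ε)
      = l ^ 3 * (fsD Δ tpd c ε + 2 * fsN tpd tpp c ε) by ring,
    show -(l ^ 3 * fsN tpd tpp c ε) = l ^ 3 * (-fsN tpd tpp c ε) by ring,
    mul_div_mul_left _ _ h3]

/-- The contour at energy `λε` of the rescaled model is the contour at energy `ε` of the original model
(same k-set), `λ ≠ 0`. [folklore] -/
theorem charCubic_smul_eq_zero_iff {l : ℝ} (hl : l ≠ 0) (Δ tpd tpp c x y ε : ℝ) :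
    charCubic (l * Δ) (l * tpd) (l * tpp) (l * c) x y (l * ε) = 0 ↔ charCubic Δ tpd tpp c x y ε = 0 := by
  rw [charCubic_smul]
  constructor
  · intro h
    rcases mul_eq_zero.mp h with h3 | h0
    · exact absurd h3 (pow_ne_zero 3 hl)
    · exact h0
  · intro h
    rw [h, mul_zero]

end Summit.Ventures.CertifiedManyBodySolver.Downfold.Emery
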